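import Literature.MathematicalPhysics.QuantumFieldTheory.Balaban1983to89.B9B8KnitAveragingClosenessOfColumns
import Literature.MathematicalPhysics.QuantumFieldTheory.Balaban1983to89.B9B8KnitNeumannCore
import Literature.MathematicalPhysics.QuantumFieldTheory.Balaban1983to89.B8Thm2TorusLettersPerOfKnit
import Literature.MathematicalPhysics.QuantumFieldTheory.Balaban1983to89.B9B8KnitLetterRegular
import Literature.MathematicalPhysics.QuantumFieldTheory.Balaban1983to89.B9B8KnitLandauProjection
import Literature.MathematicalPhysics.QuantumFieldTheory.Balaban1983to89.B13CurlIncidenceNumerals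
import Literature.MathematicalPhysics.QuantumFieldTheory.Balaban1983to89.B9Thm310CommutatorDataOfPlaquettes
import Literature.MathematicalPhysics.QuantumFieldTheory.Balaban1983to89.B9Eq3104CommutatorSizesCurv

/-!
# `Balaban1983to89.B9B8KnitCurvatureSmallness` — T. Bałaban, *Propagators for lattice gauge theories in a background field*, Commun. Math. Phys. **99**
# (1985) 389–434 [Balaban1985BackgroundPropagators], (3.7) p. 391 (`Re U(∂p)`, `Im U(∂p)`), (3.9)–(3.10) p. 392 (`Δ_U = D*_U D_U + Δ′_U`: the Jordan insertion
# and the commutator part of the curvature operator), (3.69) p. 404 («|Re U(∂p) − 1| ≤ …, |Im U(∂p)| ≤ … follow directly from the assumptions»); *Averaging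
# operations for lattice gauge theories*, CMP **98** (1985) 17–51 [Balaban1985Averaging], (5), (9) p. 18; *Propagators and renormalization transformations … I*,
# CMP **95** (1984) [Balaban1985RegularSpaces], (1.7)–(1.8) p. 77, (1.59)–(1.60) pp. 86–87 (the weighted members of the socket): **THE CURVATURE SMALLNESS `κ`
# OF THE TORUS SOCKET, PER BACKGROUND** — the (B)-line bond junction, file F5 (after F1–F4 `B9B8KnitColumnFlatness` ∕ `…ColumnGauge` ∕
# `…AveragingClosenessAtCorner` ∕ `…AveragingClosenessAtCentre`).

statement-level skeleton of published theorems with citation tags; proofs where landed; nothing here is a claim about the Yang–Mills mass gap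

THE TARGET.  The binder `hY` of the torus socket `B9B8KnitTorusSocketBetaZero.sockB9P3Per_torusIdx_of_sectors₀` asks, per admissible background `U₀`
(`U = bgY i U₀`), besides the `Δ_a`-side members and the averaging closeness `hQQ` (F3∕F4), for the CURVATURE conjunct
`hcurv : ∀ a, (∀ b, IsSelfAdjoint (a b)) → |D*_U(𝒦_U D_U a − D_U a) + Δ′₂(U) a|₍₋₃₎ ≤ κ·|a|₍₋₁₎` (`coCurlY`, `jordanY`, `curlY`, `curv2Y` = NODE 00's letters of
[B9] (3.9)–(3.10); `|·|₍β₎ = wNormBY i β`), with `κ` entering the smallness condition `2(κ + 14d·M·a_T + ε_Q)B₀ ≤ 1`.  The tree had no sup-norm supplier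
for it (t2s-1 g7 `BLINE-DESIGN-g7.md` §0 (Y4)); PRIOR ART DECLARED: the FORM version of the same two estimates at the fibre `M_N(ℂ)` (Hilbert–Schmidt ∕
trace pairing) is n06-j's `B9Ineq369CurvatureSmallAtLettersY` (which states «NOT ANYWHERE in this pair: the sup-norm (pointwise) form of (3.69)»); this file is
the SUP-NORM (pointwise, weighted) form the socket's `hcurv` asks for, over a general C⋆-algebra fibre, and imports that file's `norm_sgnY` by name.  THIS FILE supplies it, for EVERY `a` (a fortiori for Hermitian `a`), with
`κ = (w₋₃∕w₋₁)·48(d+1)·c_f²·L^{−2n}·α` — at `c_f = L^{n+1}` the prefactor `(w₋₃∕w₋₁)·c_f²·L^{−2n}` equals `1`, so `κ = 48(d+1)·α`: print's «the curvature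
terms are O(α₀)» ((3.69) p.404) in def-Y's weighted currency.

THE ROAD (print's two sentences, (3.69) p.404 and (3.10) p.392, made quantitative at NODE 00's `rfl`-level letters).
* §1 (any unitary `U : CfgY 𝔸 i` with `‖U(∂p) − 1‖ ≤ θ` at every plaquette; `𝔸` a C⋆-algebra): `(𝒦_U F − F)(p) = ½(F(p)·(Re U(∂p) − 1) + (Re U(∂p) − 1)·F(p))`
  with `‖Re U(∂p) − 1‖ ≤ ‖U(∂p) − 1‖` (`B9Thm310CommutatorDataOfPlaquettes.norm_reHolY_sub_one_le`), `‖(D_U a)(p)‖ ≤ 4|c_f|·‖a‖` and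
  `‖(D*_U G)(b)‖ ≤ 4(d+1)|c_f|·sup‖G‖` (the curl ∕ co-curl transport by bond variables or `1`, and the tree's incidence numerals
  `B13CurlIncidenceNumerals.sum_abs_curlK_le` ∕ `sum_abs_cocurlK_le`), whence the JORDAN TERM `≤ 16(d+1)c_f²θ‖a‖` (`norm_coCurlY_jordan_sub_apply_le`); and
  `Δ′₂(U)a(b) = ½Σ_{(p,m): b_m(p) = b} σ_m R(V_m)⁻¹ i[S_m(a), c_f²·Im U(∂p)]` (`B9Eq3104CommutatorSizesCurv.curv2Y_apply`) with `‖c_f²·Im U(∂p)‖ ≤ c_f²θ`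
  (`norm_cfsq_imHolY_le`), `‖i[X, M]‖ ≤ 2‖M‖‖X‖`, `‖S_m(a)‖ ≤ 8‖a‖`, at most `4(d+1)` contour positions per bond (`sum_sum_ite_edgeY_le`), whence the COMMUTATOR
  TERM `≤ 32(d+1)c_f²θ‖a‖` (`norm_curv2Y_apply_le`); together `norm_curvature_apply_le` (`48(d+1)c_f²θ‖a‖`).
* §2 (the member's background): for an `N₀`-periodic `U₀` in the regime `Reg17 L n ℤ^{d+1} α` every torus plaquette has `‖U(∂p) − 1‖ < α·L^{−2n}` at
  `U = bgY i U₀` (`norm_holY_bgY_sub_one_lt`: the knit's plaquette holonomy of the lift IS def-Y's `holY`, `B9B8KnitLetterRegular.hol_liftCfg_plaqWord`, and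
  the lift of `bgY i U₀` is `U₀`); at constant level the weighted norms are `w_β·sup` (`B9B8KnitNeumannCore.wNormBY_eq_weight_mul_norm`), whence ★★★ `hcurv_bgY`
  and, in the socket's binder shape (threshold `a_T`, every `α₀ ≤ a_T`, every unitary periodic `U₀ ∈ InAk L n η α₀ ℤ^{d+1}`), ★★★ `hcurv_bgY_of_inAk`
  (`B9Eq316AveragingTransposeZd.reg17_of_inAk` ∕ `reg17_mono`).

WHAT THIS FILE PROVES (all `theorem`s; 0 `def`, 0 new named facts, 0 `sorry`; standard axioms).
* §1 `curlY_apply_eq`, `coCurlY_apply_eq`, `curlT_mem`, `edgeParY_mem`, `norm_primeEdgeY_le` (the tree's `B9Ineq369CurvatureSmallAtLettersY.norm_sgnY`,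
  `B13OpsYPencilHessian.norm_commY_le` BY NAME), ★ `norm_curlY_apply_le`,
  ★ `norm_coCurlY_apply_le`, ★ `norm_jordanY_sub_apply_le`, ★★ `norm_coCurlY_jordan_sub_apply_le`, ★★ `norm_curv2Y_apply_le`, ★★ `norm_curvature_apply_le`.
* §2 ★ `norm_holY_bgY_sub_one_lt`, ★★★ `hcurv_bgY`, ★★★ `hcurv_bgY_of_inAk`.

HONEST FRAMING.  Finite-lattice bookkeeping over NODE 00's `rfl`-level definitions (`curlY`, `coCurlY`, `jordanY`, `curv2Y`, `holY`, `reHolY`, `imHolY`) and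
the tree's incidence numerals ∕ plaquette-size lemmas, cited BY NAME; the constant `48(d+1)` is crude (print's «O(1)»: the sharp count is `2d` plaquettes per
bond and `3` primed variables per contour position); nothing of NODE 00's, N06's, p38's or the lane's files is modified; nothing of Bałaban's Thm 3.3 ∕ 3.10
is asserted; the OTHER conjuncts of `hY` (the `Δ_a`-side members, `IsUnit` clauses) remain displayed; `stub_PV3A` NOT discharged; counts unmoved; one finite
𝕋⁴ programme at fixed ε, Bałaban AS PRINTED; the YM mass gap (Clay) is NOT proved by any of this — nothing continuum ∕ ℝ⁴ ∕ OS.  Cell `lit-balaban`, seat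
t2s-1 g8 («B8 §3 Thm 2 TORUS SUPPLIER», (B)-line bond junction); `--supports stmt-QuantumFields-19200 --as helper`.

References: T. Bałaban, CMP 99 (1985) 389–434 [Balaban1985BackgroundPropagators] (3.1)–(3.10) pp.390–392, (3.41) p.397, (3.69) p.404; CMP 98 (1985) 17–51
[Balaban1985Averaging] (5), (9) p.18, (52) p.26; CMP 95 (1984) 17–40 [Balaban1985RegularSpaces] (1.7)–(1.8) p.77, (1.59)–(1.60) pp.86–87.
-/

noncomputable section

namespace Literature.MathematicalPhysics.QuantumFieldTheory.Balaban1983to89.B9B8KnitCurvatureSmallness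

open scoped BigOperators
open Node00
open B7Prop1Explicit renaming Site → LSite
open B7Prop1Explicit (plaqWord hol)
open B7Prop2Explicit (unitaryUnits unitaryUnits_le_U1)
open B8Ineq132 (plaqF InAk)
open B6KLevelCensusIndexV1 (KIdx)
open B6GlobalChartV1 (PV)
open B8ScaledSupNorm (weight)
open B10Eq27TorusAxialLog (transl rel transl_rel)
open B9B8CarrierDictionary (liftCfg)
open B9B8KnitLetterRegular (hol_liftCfg_plaqWord)
open B9B8KnitNeumannCore (wNormBY_eq_weight_mul_norm)
open B9B8KnitNormsTransfer (weight_level_pos)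
open B9B8KnitAveragingClosenessOfColumns (norm_R_le_of_mem_unitaryUnits)
open B9Eq316AveragingTransposeZd (Reg17 reg17_mono reg17_of_inAk)
open B8Thm2TorusLettersPerOfKnit (bgY liftCfg_bgY bgY_mem)
open B9B8KnitLandauProjection (shiftCfg_eq_of_isPeriodic)
open T4TermwiseTorus (IsPeriodic)
open B9Eq39Adjoint (R R_smul R_sub)
open B13CurlIncidenceNumerals (sum_abs_curlK_le sum_abs_cocurlK_le sum_sum_ite_edgeY_le)
open B9Thm310CommutatorDataOfPlaquettes (bicontr_holY norm_reHolY_sub_one_le norm_cfsq_imHolY_le)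
open B9Eq3104CommutatorSizesCurv (curv2Y_apply)
open B9Ineq369CurvatureSmallAtLettersY (norm_sgnY)
open B13OpsYPencilHessian (norm_commY_le)

variable {d ℓ : ℕ} {hd : 1 ≤ d + 1} {hL : Odd (ℓ + 1) ∧ 1 < ℓ + 1} {b₀ b₁ : ℝ}

/-! ## §1 The curvature letters at a unitary configuration with small plaquette fields -/

section Letters

variable {𝔸 : Type} [CStarAlgebra 𝔸] [Nontrivial 𝔸] (i : KIdx d ℓ hd hL b₀ b₁)

omit [Nontrivial 𝔸] in
/-- `(D_U a)(p) = Σ_b ∂(p,b)·R(V(p,b))a(b)`. [cite: Balaban1985BackgroundPropagators, (3.4) p.391] -/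
theorem curlY_apply_eq (U : CfgY 𝔸 i) (a : FBondY i → 𝔸) (p : PlaqY i) :
    curlY i U a p = ∑ b, ((curlK i p b : ℝ) : ℂ) • R (curlT i U p b) (a b) := by
  rw [curlY, trLiftY_apply]

omit [Nontrivial 𝔸] in
/-- `(D*_U G)(b) = Σ_p ∂*(b,p)·R(V(p,b))⁻¹G(p)`. [cite: Balaban1985BackgroundPropagators, (3.9) p.392] -/
theorem coCurlY_apply_eq (U : CfgY 𝔸 i) (G : PlaqY i → 𝔸) (b : FBondY i) :
    coCurlY i U G b = ∑ p, ((cocurlK i b p : ℝ) : ℂ) • R (curlT i U p b)⁻¹ (G p) := by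
  rw [coCurlY, trLiftY_apply]

omit [Nontrivial 𝔸] in
/-- the transporters of the covariant curl are bond variables or `1`. [cite: Balaban1985BackgroundPropagators, (3.4) p.391] -/
theorem curlT_mem {G : Subgroup 𝔸ˣ} {U : CfgY 𝔸 i} (hU : ∀ μ x, U μ x ∈ G) (p : PlaqY i) (b : FBondY i) : curlT i U p b ∈ G := by
  unfold curlT
  split_ifs
  · exact hU _ _
  · exact hU _ _
  · exact G.one_mem

omit [Nontrivial 𝔸] in
/-- the transporters of the primed contour variables are bond variables or `1`. [cite: Balaban1985BackgroundPropagators, (3.2) p.390] -/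
theorem edgeParY_mem {G : Subgroup 𝔸ˣ} {U : CfgY 𝔸 i} (hU : ∀ μ x, U μ x ∈ G) (p : PlaqY i) (m : Fin 4) : edgeParY i U p m ∈ G := by
  fin_cases m
  · exact hU _ _
  · exact G.one_mem
  · exact G.one_mem
  · exact hU _ _

/-- `‖A′(b_l)‖ ≤ ‖a‖` for unitary `U`. [cite: Balaban1985BackgroundPropagators, (3.2) p.390] -/
theorem norm_primeEdgeY_le {U : CfgY 𝔸 i} (hU : ∀ μ x, U μ x ∈ unitaryUnits 𝔸) (p : PlaqY i) (l : Fin 4) (a : FBondY i → 𝔸) :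
    ‖primeEdgeY i U p l a‖ ≤ ‖a‖ := by
  show ‖sgnY l • R (edgeParY i U p l) (a (edgeY i p l))‖ ≤ ‖a‖
  rw [norm_smul, norm_sgnY, one_mul]
  exact (norm_R_le_of_mem_unitaryUnits (edgeParY_mem i hU p l) _).trans (norm_le_pi_norm a _)

/-- ★ `‖(D_U a)(p)‖ ≤ 4|c_f|·‖a‖` at a unitary `U`. [cite: Balaban1985BackgroundPropagators, (3.4) p.391] -/
theorem norm_curlY_apply_le {U : CfgY 𝔸 i} (hU : ∀ μ x, U μ x ∈ unitaryUnits 𝔸) (a : FBondY i → 𝔸) (p : PlaqY i) :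
    ‖curlY i U a p‖ ≤ 4 * |i.cf| * ‖a‖ := by
  classical
  rw [curlY_apply_eq]
  calc ‖∑ b, ((curlK i p b : ℝ) : ℂ) • R (curlT i U p b) (a b)‖ ≤ ∑ b, ‖((curlK i p b : ℝ) : ℂ) • R (curlT i U p b) (a b)‖ := norm_sum_le _ _
    _ ≤ ∑ b, |curlK i p b| * ‖a‖ := Finset.sum_le_sum fun b _ => by
        rw [norm_smul, Complex.norm_real, Real.norm_eq_abs]
        exact mul_le_mul_of_nonneg_left ((norm_R_le_of_mem_unitaryUnits (curlT_mem i hU p b) _).trans (norm_le_pi_norm a b)) (abs_nonneg _)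
    _ = (∑ b, |curlK i p b|) * ‖a‖ := by rw [Finset.sum_mul]
    _ ≤ 4 * |i.cf| * ‖a‖ := mul_le_mul_of_nonneg_right (sum_abs_curlK_le i p) (norm_nonneg _)

/-- ★ `‖(D*_U G)(b)‖ ≤ 4(d+1)|c_f|·sup‖G‖` at a unitary `U`. [cite: Balaban1985BackgroundPropagators, (3.9) p.392] -/
theorem norm_coCurlY_apply_le {U : CfgY 𝔸 i} (hU : ∀ μ x, U μ x ∈ unitaryUnits 𝔸) (G : PlaqY i → 𝔸) {g : ℝ} (hg0 : 0 ≤ g) (hg : ∀ p, ‖G p‖ ≤ g)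
    (b : FBondY i) : ‖coCurlY i U G b‖ ≤ 4 * ((d : ℝ) + 1) * |i.cf| * g := by
  classical
  rw [coCurlY_apply_eq]
  calc ‖∑ p, ((cocurlK i b p : ℝ) : ℂ) • R (curlT i U p b)⁻¹ (G p)‖ ≤ ∑ p, ‖((cocurlK i b p : ℝ) : ℂ) • R (curlT i U p b)⁻¹ (G p)‖ := norm_sum_le _ _
    _ ≤ ∑ p, |cocurlK i b p| * g := Finset.sum_le_sum fun p _ => by
        rw [norm_smul, Complex.norm_real, Real.norm_eq_abs]
        exact mul_le_mul_of_nonneg_left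
          ((norm_R_le_of_mem_unitaryUnits ((unitaryUnits 𝔸).inv_mem (curlT_mem i hU p b)) _).trans (hg p)) (abs_nonneg _)
    _ = (∑ p, |cocurlK i b p|) * g := by rw [Finset.sum_mul]
    _ ≤ 4 * ((d : ℝ) + 1) * |i.cf| * g := mul_le_mul_of_nonneg_right (sum_abs_cocurlK_le i b) hg0

/-- ★ `‖(𝒦_U F)(p) − F(p)‖ ≤ ‖U(∂p) − 1‖·‖F(p)‖` at a unitary `U` (`𝒦_U F − F = ½(F·(Re U(∂p) − 1) + (Re U(∂p) − 1)·F)`).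
[cite: Balaban1985BackgroundPropagators, (3.7) p.391, (3.10) p.392, (3.69) p.404] -/
theorem norm_jordanY_sub_apply_le {U : CfgY 𝔸 i} (hU : ∀ μ x, U μ x ∈ unitaryUnits 𝔸) (F : PlaqY i → 𝔸) (p : PlaqY i) :
    ‖jordanY i U F p - F p‖ ≤ ‖((holY i U p : 𝔸ˣ) : 𝔸) - 1‖ * ‖F p‖ := by
  have hU1 : ∀ μ x, ‖(U μ x : 𝔸)‖ ≤ 1 ∧ ‖(((U μ x)⁻¹ : 𝔸ˣ) : 𝔸)‖ ≤ 1 := fun μ x =>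
    B7Prop1Explicit.mem_U1.1 (unitaryUnits_le_U1 (hU μ x))
  have hRe := norm_reHolY_sub_one_le i U p (bicontr_holY i U hU1 p)
  have e : jordanY i U F p - F p = (1 / 2 : ℂ) • (F p * (reHolY i U p - 1) + (reHolY i U p - 1) * F p) := by
    rw [B13OpsYPencilHolonomy.jordanY_apply, mul_sub, sub_mul, mul_one, one_mul]
    module
  rw [e, norm_smul]
  have hn : ‖(1 / 2 : ℂ)‖ = 1 / 2 := by norm_num
  rw [hn]
  have h1 : ‖F p * (reHolY i U p - 1)‖ ≤ ‖F p‖ * ‖reHolY i U p - 1‖ := norm_mul_le _ _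
  have h2 : ‖(reHolY i U p - 1) * F p‖ ≤ ‖reHolY i U p - 1‖ * ‖F p‖ := norm_mul_le _ _
  have h3 := norm_add_le (F p * (reHolY i U p - 1)) ((reHolY i U p - 1) * F p)
  have hF : 0 ≤ ‖F p‖ := norm_nonneg _
  nlinarith [mul_le_mul_of_nonneg_right hRe hF]

/-- ★★ **THE JORDAN TERM**: `‖(D*_U(𝒦_U − 1)D_U a)(b)‖ ≤ 16(d+1)·c_f²·θ·‖a‖` at a unitary `U` with `‖U(∂p) − 1‖ ≤ θ` at every plaquette.
[cite: Balaban1985BackgroundPropagators, (3.7) p.391, (3.9)–(3.10) p.392, (3.69) p.404; Balaban1985RegularSpaces, (1.59) p.86] -/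
theorem norm_coCurlY_jordan_sub_apply_le {U : CfgY 𝔸 i} (hU : ∀ μ x, U μ x ∈ unitaryUnits 𝔸) {θ : ℝ} (hθ : 0 ≤ θ)
    (hW : ∀ p : PlaqY i, ‖((holY i U p : 𝔸ˣ) : 𝔸) - 1‖ ≤ θ) (a : FBondY i → 𝔸) (b : FBondY i) :
    ‖coCurlY i U (jordanY i U (curlY i U a) - curlY i U a) b‖ ≤ 16 * ((d : ℝ) + 1) * i.cf ^ 2 * θ * ‖a‖ := by
  have hG : ∀ p, ‖(jordanY i U (curlY i U a) - curlY i U a) p‖ ≤ θ * (4 * |i.cf| * ‖a‖) := fun p => by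
    rw [Pi.sub_apply]
    refine (norm_jordanY_sub_apply_le i hU (curlY i U a) p).trans ?_
    exact mul_le_mul (hW p) (norm_curlY_apply_le i hU a p) (norm_nonneg _) hθ
  refine (norm_coCurlY_apply_le i hU _ (by positivity) hG b).trans (le_of_eq ?_)
  rw [show i.cf ^ 2 = |i.cf| * |i.cf| by rw [← sq, sq_abs]]
  ring

/-- ★★ **THE COMMUTATOR TERM**: `‖(Δ′₂(U) a)(b)‖ ≤ 32(d+1)·c_f²·θ·‖a‖` at a unitary `U` with `‖U(∂p) − 1‖ ≤ θ` at every plaquette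
(`‖c_f²·Im U(∂p)‖ ≤ c_f²θ`, `‖i[X, M]‖ ≤ 2‖M‖‖X‖`, at most `4(d+1)` contour positions per bond, `‖A′‖ ≤ ‖a‖`).
[cite: Balaban1985BackgroundPropagators, (3.10) p.392, (3.2) p.390, (3.69) p.404; Balaban1985RegularSpaces, (1.60) p.87] -/
theorem norm_curv2Y_apply_le {U : CfgY 𝔸 i} (hU : ∀ μ x, U μ x ∈ unitaryUnits 𝔸) {θ : ℝ} (hθ : 0 ≤ θ)
    (hW : ∀ p : PlaqY i, ‖((holY i U p : 𝔸ˣ) : 𝔸) - 1‖ ≤ θ) (a : FBondY i → 𝔸) (b : FBondY i) :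
    ‖curv2Y i U a b‖ ≤ 32 * ((d : ℝ) + 1) * i.cf ^ 2 * θ * ‖a‖ := by
  classical
  have hU1 : ∀ μ x, ‖(U μ x : 𝔸)‖ ≤ 1 ∧ ‖(((U μ x)⁻¹ : 𝔸ˣ) : 𝔸)‖ ≤ 1 := fun μ x =>
    B7Prop1Explicit.mem_U1.1 (unitaryUnits_le_U1 (hU μ x))
  -- the inner difference of primed variables has norm ≤ 8‖a‖
  have hS : ∀ (p : PlaqY i) (m : Fin 4),
      ‖(∑ l : Fin 4, (if m < l then primeEdgeY i U p l else 0)) a - (∑ l : Fin 4, (if l < m then primeEdgeY i U p l else 0)) a‖ ≤ 8 * ‖a‖ := by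
    intro p m
    have hone : ∀ (q : Fin 4 → Prop) [DecidablePred q], ‖(∑ l : Fin 4, (if q l then primeEdgeY i U p l else 0)) a‖ ≤ 4 * ‖a‖ := by
      intro q _
      rw [LinearMap.sum_apply]
      calc ‖∑ l : Fin 4, (if q l then primeEdgeY i U p l else 0) a‖ ≤ ∑ l : Fin 4, ‖(if q l then primeEdgeY i U p l else 0) a‖ := norm_sum_le _ _
        _ ≤ ∑ l : Fin 4, ‖a‖ := Finset.sum_le_sum fun l _ => by
            split_ifs
            · exact norm_primeEdgeY_le i hU p l a
            · rw [LinearMap.zero_apply, norm_zero]; exact norm_nonneg _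
        _ = 4 * ‖a‖ := by simp
    calc _ ≤ ‖(∑ l : Fin 4, (if m < l then primeEdgeY i U p l else 0)) a‖ + ‖(∑ l : Fin 4, (if l < m then primeEdgeY i U p l else 0)) a‖ :=
          norm_sub_le _ _
      _ ≤ 4 * ‖a‖ + 4 * ‖a‖ := add_le_add (hone _) (hone _)
      _ = 8 * ‖a‖ := by ring
  -- each contour position contributes ≤ 16 c_f² θ ‖a‖
  have hterm : ∀ (p : PlaqY i) (m : Fin 4),
      ‖(if edgeY i p m = b then
        sgnY m • R (edgeParY i U p m)⁻¹ (commY (((i.cf ^ 2 : ℝ) : ℂ) • imHolY i U p)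
          ((∑ l : Fin 4, (if m < l then primeEdgeY i U p l else 0)) a - (∑ l : Fin 4, (if l < m then primeEdgeY i U p l else 0)) a))
        else 0)‖ ≤ (if edgeY i p m = b then (1 : ℝ) else 0) * (16 * i.cf ^ 2 * θ * ‖a‖) := by
    intro p m
    split_ifs with h
    · rw [one_mul, norm_smul, norm_sgnY, one_mul]
      refine (norm_R_le_of_mem_unitaryUnits ((unitaryUnits 𝔸).inv_mem (edgeParY_mem i hU p m)) _).trans ?_
      refine (norm_commY_le _ _).trans ?_
      have hM := norm_cfsq_imHolY_le i U p (bicontr_holY i U hU1 p)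
      have hM' : ‖((i.cf ^ 2 : ℝ) : ℂ) • imHolY i U p‖ ≤ i.cf ^ 2 * θ := hM.trans (mul_le_mul_of_nonneg_left (hW p) (sq_nonneg _))
      calc 2 * ‖((i.cf ^ 2 : ℝ) : ℂ) • imHolY i U p‖ * _ ≤ 2 * (i.cf ^ 2 * θ) * (8 * ‖a‖) := by
            gcongr
            exact hS p m
        _ = 16 * i.cf ^ 2 * θ * ‖a‖ := by ring
    · rw [norm_zero, zero_mul]
  rw [curv2Y_apply, norm_smul]
  have hn : ‖(1 / 2 : ℂ)‖ = 1 / 2 := by norm_num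
  rw [hn]
  have hsum := sum_sum_ite_edgeY_le i b
  calc 1 / 2 * ‖∑ p : PlaqY i, ∑ m : Fin 4, _‖ ≤ 1 / 2 * ∑ p : PlaqY i, ∑ m : Fin 4, (if edgeY i p m = b then (1 : ℝ) else 0) * (16 * i.cf ^ 2 * θ * ‖a‖) := by
        gcongr
        exact (norm_sum_le _ _).trans (Finset.sum_le_sum fun p _ => (norm_sum_le _ _).trans (Finset.sum_le_sum fun m _ => hterm p m))
    _ = 1 / 2 * ((∑ p : PlaqY i, ∑ m : Fin 4, (if edgeY i p m = b then (1 : ℝ) else 0)) * (16 * i.cf ^ 2 * θ * ‖a‖)) := by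
        rw [Finset.sum_mul]; congr 1; refine Finset.sum_congr rfl fun p _ => ?_; rw [Finset.sum_mul]
    _ ≤ 1 / 2 * ((4 * ((d : ℝ) + 1)) * (16 * i.cf ^ 2 * θ * ‖a‖)) := by gcongr
    _ = 32 * ((d : ℝ) + 1) * i.cf ^ 2 * θ * ‖a‖ := by ring

/-- ★★ **THE CURVATURE TERM OF THE SOCKET, POINTWISE**: `‖(D*_U(𝒦_U − 1)D_U a + Δ′₂(U)a)(b)‖ ≤ 48(d+1)·c_f²·θ·‖a‖` at a unitary `U` whose plaquette variables
are within `θ` of `1`. [cite: Balaban1985BackgroundPropagators, (3.9)–(3.10) p.392, (3.69) p.404; Balaban1985RegularSpaces, (1.59)–(1.60) pp.86–87] -/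
theorem norm_curvature_apply_le {U : CfgY 𝔸 i} (hU : ∀ μ x, U μ x ∈ unitaryUnits 𝔸) {θ : ℝ} (hθ : 0 ≤ θ)
    (hW : ∀ p : PlaqY i, ‖((holY i U p : 𝔸ˣ) : 𝔸) - 1‖ ≤ θ) (a : FBondY i → 𝔸) (b : FBondY i) :
    ‖(coCurlY i U (jordanY i U (curlY i U a) - curlY i U a) + curv2Y i U a) b‖ ≤ 48 * ((d : ℝ) + 1) * i.cf ^ 2 * θ * ‖a‖ := by
  rw [Pi.add_apply]
  refine (norm_add_le _ _).trans ?_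
  have h1 := norm_coCurlY_jordan_sub_apply_le i hU hθ hW a b
  have h2 := norm_curv2Y_apply_le i hU hθ hW a b
  linarith

end Letters

/-! ## §2 The member's background: plaquette fields from the regime (1.7), and the weighted curvature smallness `κ` -/

section Background

variable {𝔸 : Type} [CStarAlgebra 𝔸] [Nontrivial 𝔸] (i : KIdx d ℓ hd hL b₀ b₁) {n : ℕ}

omit [Nontrivial 𝔸] in
/-- ★ **THE TORUS PLAQUETTE FIELDS OF `bgY i U₀` FROM THE REGIME (1.7)**: for an `N₀`-periodic `U₀ ∈ Reg17 L n ℤ^{d+1} α` (class (1.7) up to level `n` on all of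
`ℤ^{d+1}`), every plaquette of the member's torus satisfies `‖U(∂p) − 1‖ < α·L^{−2n}` at `U = bgY i U₀` (the knit's plaquette holonomy of the lift read on
def-Y's torus, `B9B8KnitLetterRegular.hol_liftCfg_plaqWord`). [cite: Balaban1985RegularSpaces, (1.7) p.77, p.77 («Ω_j = T_η»); Balaban1985BackgroundPropagators, (3.1) p.390, (3.69) p.404] -/
theorem norm_holY_bgY_sub_one_lt {α : ℝ} {U₀ : LSite (d + 1) → Fin (d + 1) → 𝔸ˣ}
    (hper : IsPeriodic ((PV d ℓ i.m i.K hd hL).sitesPerDir 0) U₀)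
    (hreg : Reg17 (ℓ + 1) n (fun _ => (Set.univ : Set (LSite (d + 1)))) α U₀) (p : PlaqY i) :
    ‖((holY i (bgY i U₀) p : 𝔸ˣ) : 𝔸) - 1‖ < α * (((((ℓ + 1 : ℕ) : ℝ)) ^ n)⁻¹) ^ 2 := by
  have hlift : liftCfg (bgY i U₀) = U₀ := liftCfg_bgY i fun μ => shiftCfg_eq_of_isPeriodic hper μ
  obtain ⟨s, μ, ν, hμν⟩ := p
  have h := hol_liftCfg_plaqWord i (bgY i U₀) (rel (0 : Site (PV d ℓ i.m i.K hd hL) 0) s) hμν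
  rw [transl_rel, hlift] at h
  rw [← h]
  have hr := hreg n le_rfl (rel (0 : Site (PV d ℓ i.m i.K hd hL) 0) s) μ ν (ne_of_lt hμν) (Or.inl (Set.mem_univ _))
  simpa [plaqF] using hr

/-- ★★★ **THE CURVATURE SMALLNESS `κ` OF THE TORUS SOCKET, PER BACKGROUND.**  At a member of constant level `n` (every site of level `n`), for a unitary,
`N₀`-periodic background `U₀ ∈ Reg17 L n ℤ^{d+1} α` (`α ≥ 0`) and `U = bgY i U₀`: for EVERY bond function `a`,
`|D*_U(𝒦_U − 1)D_U a + Δ′₂(U)a|₍₋₃₎ ≤ κ·|a|₍₋₁₎` with `κ = (w₋₃∕w₋₁)·48(d+1)·c_f²·L^{−2n}·α` (`w_β = weight L |c_f|⁻¹ β n`; at `c_f = L^{n+1}` the prefactor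
`(w₋₃∕w₋₁)·c_f²·L^{−2n}` is `1`) — the curvature conjunct `hcurv` of `B9B8KnitTorusSocketBetaZero.sockB9P3Per_torusIdx_of_sectors₀`'s binder `hY`, a fortiori for
Hermitian `a`. [cite: Balaban1985RegularSpaces, (1.59)–(1.60) pp.86–87, (1.7) p.77; Balaban1985BackgroundPropagators, (3.9)–(3.10) p.392, (3.41) p.397, (3.69) p.404] -/
theorem hcurv_bgY (hlev : ∀ z : SiteY i, levY i z = n) {α : ℝ} (hα : 0 ≤ α)
    {U₀ : LSite (d + 1) → Fin (d + 1) → 𝔸ˣ} (hU₀ : ∀ x κ, U₀ x κ ∈ unitaryUnits 𝔸)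
    (hper : IsPeriodic ((PV d ℓ i.m i.K hd hL).sitesPerDir 0) U₀)
    (hreg : Reg17 (ℓ + 1) n (fun _ => (Set.univ : Set (LSite (d + 1)))) α U₀) (a : FBondY i → 𝔸) :
    wNormBY i (-3) (coCurlY i (bgY i U₀) (jordanY i (bgY i U₀) (curlY i (bgY i U₀) a) - curlY i (bgY i U₀) a) + curv2Y i (bgY i U₀) a) ≤
      (weight (ℓ + 1) |i.cf|⁻¹ (-3) n / weight (ℓ + 1) |i.cf|⁻¹ (-1) n *
        (48 * ((d : ℝ) + 1) * i.cf ^ 2 * (((((ℓ + 1 : ℕ) : ℝ)) ^ n)⁻¹) ^ 2 * α)) * wNormBY i (-1) a := by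
  have hU : ∀ μ x, bgY i U₀ μ x ∈ unitaryUnits 𝔸 := bgY_mem i hU₀
  set θ : ℝ := α * (((((ℓ + 1 : ℕ) : ℝ)) ^ n)⁻¹) ^ 2 with hθ
  have hθ0 : 0 ≤ θ := by positivity
  have hW : ∀ p : PlaqY i, ‖((holY i (bgY i U₀) p : 𝔸ˣ) : 𝔸) - 1‖ ≤ θ := fun p => (norm_holY_bgY_sub_one_lt i hper hreg p).le
  set E := coCurlY i (bgY i U₀) (jordanY i (bgY i U₀) (curlY i (bgY i U₀) a) - curlY i (bgY i U₀) a) + curv2Y i (bgY i U₀) a with hE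
  set C : ℝ := 48 * ((d : ℝ) + 1) * i.cf ^ 2 * θ with hC
  have hpt : ∀ b : FBondY i, ‖E b‖ ≤ C * ‖a‖ := fun b => norm_curvature_apply_le i hU hθ0 hW a b
  have hC0 : 0 ≤ C * ‖a‖ := by positivity
  have hsup : ‖E‖ ≤ C * ‖a‖ := (pi_norm_le_iff_of_nonneg hC0).2 hpt
  set w₁ : ℝ := weight (ℓ + 1) |i.cf|⁻¹ (-1) n with hw₁def
  set w₃ : ℝ := weight (ℓ + 1) |i.cf|⁻¹ (-3) n with hw₃def
  have hw₁ : 0 < w₁ := weight_level_pos i (-1 : ℝ) n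
  have hw₃ : 0 < w₃ := weight_level_pos i (-3 : ℝ) n
  rw [wNormBY_eq_weight_mul_norm i hlev, wNormBY_eq_weight_mul_norm i hlev]
  calc w₃ * ‖E‖ ≤ w₃ * (C * ‖a‖) := mul_le_mul_of_nonneg_left hsup hw₃.le
    _ = w₃ / w₁ * (48 * ((d : ℝ) + 1) * i.cf ^ 2 * (((((ℓ + 1 : ℕ) : ℝ)) ^ n)⁻¹) ^ 2 * α) * (w₁ * ‖a‖) := by
        rw [hC, hθ]; field_simp

/-- ★★★ **THE SAME IN THE SOCKET's BINDER SHAPE**: for a threshold `0 ≤ a_T`, every `α₀ ≤ a_T` and every unitary `N₀`-periodic `U₀ ∈ InAk L n η α₀ ℤ^{d+1}`: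
`∀ a, |D*_U(𝒦_U − 1)D_U a + Δ′₂(U)a|₍₋₃₎ ≤ κ(a_T)·|a|₍₋₁₎` at `U = bgY i U₀`, `κ(a_T) = (w₋₃∕w₋₁)·48(d+1)·c_f²·L^{−2n}·a_T` uniform in `α₀`, `U₀`.
[cite: Balaban1985RegularSpaces, (1.7)–(1.8) p.77, (1.59)–(1.60) pp.86–87; Balaban1985BackgroundPropagators, (3.9)–(3.10) p.392, (3.41) p.397] -/
theorem hcurv_bgY_of_inAk (hlev : ∀ z : SiteY i, levY i z = n) {η aT α₀ : ℝ} (haT : 0 ≤ aT) (hα₀T : α₀ ≤ aT)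
    {U₀ : LSite (d + 1) → Fin (d + 1) → 𝔸ˣ} (hU₀ : ∀ x κ, U₀ x κ ∈ unitaryUnits 𝔸)
    (hper : IsPeriodic ((PV d ℓ i.m i.K hd hL).sitesPerDir 0) U₀)
    (hAk : InAk (ℓ + 1) n η α₀ (fun _ => (Set.univ : Set (LSite (d + 1)))) U₀) (a : FBondY i → 𝔸) :
    wNormBY i (-3) (coCurlY i (bgY i U₀) (jordanY i (bgY i U₀) (curlY i (bgY i U₀) a) - curlY i (bgY i U₀) a) + curv2Y i (bgY i U₀) a) ≤
      (weight (ℓ + 1) |i.cf|⁻¹ (-3) n / weight (ℓ + 1) |i.cf|⁻¹ (-1) n *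
        (48 * ((d : ℝ) + 1) * i.cf ^ 2 * (((((ℓ + 1 : ℕ) : ℝ)) ^ n)⁻¹) ^ 2 * aT)) * wNormBY i (-1) a :=
  hcurv_bgY i hlev haT hU₀ hper (reg17_mono hα₀T (reg17_of_inAk hAk le_rfl)) a

end Background

end Literature.MathematicalPhysics.QuantumFieldTheory.Balaban1983to89.B9B8KnitCurvatureSmallness
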